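import Summits.BirchSwinnertonDyer.BirchSwinnertonDyer.Theorems.SignedBaseChangeAnticyclotomicEisensteinDivisibilityFinitePiece
import Summits.BirchSwinnertonDyer.BirchSwinnertonDyer.Theorems.SignedBaseChangeAnticyclotomicEisensteinDivisibilityNakayamaDualTwoVar
import Literature.NumberTheory.EllipticCurves.TwoVariableSelmerDual
import HarnessLib

/-!
# `X_Gr(E/K̃_∞)` is a finitely generated `Λ₂`-module — unconditionally, for every number field
# (corollary of the landed stubs `stub_finitePieceSS` + `stub_nakayamaDualTwoVar` of line `bdpline`,
# crux `AnticyclotomicEisensteinDivisibility`, stmt-BirchSwinnertonDyer-20727, route `SignedBaseChange`)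

The two-variable Greenberg Selmer dual
`X_Gr₂ = WeierstrassCurve.XGr₂ W p κ₁ κ₂ v̄ γ₁ γ₂ = Hom(H¹_{nr,v̄}(K̃_∞, E[p^∞]), ℚ/ℤ)` (file
`TwoVariableSelmerDual`, BCS 2025 §2.1 `X_Gr(E/K_∞)` for `K` imaginary quadratic) is a finitely
generated module over `Λ₂ = ℤ_p⟦T₂⟧⟦T₁⟧` — for ANY number field `K`, elliptic `W/K`, prime `p`, pair of
`ℤ_p`-extensions `(κ₁, κ₂)` with a topological generator pair `(γ₁, γ₂)` and place `v̄`
(`xGr₂_module_finite`). Greenberg, LNM 1716 §1 p. 60: "`X/𝔪X` is finite … By a version of Nakayama's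
Lemma … `X` is finitely generated … for any prime `p`, with no restriction on the reduction type" — here
over the `ℤ_p²`-tower: `X_Gr₂/𝔪X_Gr₂` is dual to `H¹_{nr,v̄}(K̃_∞, E[p^∞])[𝔪]`, finite by the two-step
descent of `…FinitePiece.lean` (`finite_unrSelmer₂_pTorsion_invariants`, the universe-polymorphic form
of the registered stub `stub_finitePieceSS`), and Nakayama for Pontryagin duals over `Λ₂` is w2's
`SignedBaseChangeAcDivNakayamaTwoVar.module_finite_of_dualPair₂` (Lang, *Cyclotomic Fields*, Ch. 5 §1),
applied to the CONSTRUCTED `Λ₂`-structure of `XGr₂` (`XGr₂.X_smul_apply / CX_smul_apply / CC_smul_apply`,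
`TwoVariableSelmer.isLocNil₂_conjSel₂`). This is the `Module.Finite` half of BCS25 Conj. 4.1.2's standing
hypothesis and exactly the stub `stub_fgSS` of the staged 17-SS child's skeleton
(`rev17-SS/Lines_bdpline_ratSS_prep_v2.lean`). TORSION over `Λ₂` is NOT proved here. BSD is not proved
by any of this.
-/

-- D-0017: single-problem summit, the namespace repeats the problem name by design.
set_option linter.dupNamespace false
set_option autoImplicit false

open Literature.NumberTheory.EllipticCurves Literature.NumberTheory.GaloisRepresentations
open Literature.NumberTheory.EllipticCurves.GreenbergVatsal2000
open NumberField IsDedekindDomain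

namespace Summit.BirchSwinnertonDyer.BirchSwinnertonDyer.Theorems.SignedBaseChangeAcDivFinitePiece

universe u

variable {K : Type u} [Field K] [NumberField K] (W : WeierstrassCurve K) [W.IsElliptic] (p : ℕ) [Fact p.Prime]
  (κ₁ κ₂ : ZpExtension K p) (vbar : HeightOneSpectrum (𝓞 K)) {γ₁ γ₂ : Field.absoluteGaloisGroup K}

/-- **`H¹_{nr,v̄}(K̃_∞, E[p^∞])[𝔪]` is finite** (universe-polymorphic form of the registered stub
`stub_finitePieceSS`; same proof): the classes of `unrSelmer₂ κ₁ κ₂ E[p^∞] v̄` killed by `p` and fixed by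
`conj_{γ₁}`, `conj_{γ₂}` are finite — Kummer lift (A) with finite kernel, (B')
`resOfLe_eq_zero_of_mem_unramifiedOutside`, and the two-step descent
`finite_setOf_conjH1_pair_eq_of_unramified` with `S = {bad} ∪ {v ∣ p}`. Greenberg (1999) §1 p. 60.
[cite: GreenbergLNM1716, §1 p. 60 (after Conj. 1.3)] [cite: SilvermanAEC2009, Lemma X.4.3] -/
theorem finite_unrSelmer₂_pTorsion_invariants (hγ : ZpExtension.IsTopGeneratorPair κ₁ κ₂ γ₁ γ₂) :
    Set.Finite {s : unrSelmer₂ κ₁ κ₂ (WeierstrassCurve.geomPrimaryTorsion W p) vbar |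
      p • s = 0 ∧ conjSel₂ κ₁ κ₂ (WeierstrassCurve.geomPrimaryTorsion W p) vbar γ₁ s = s ∧
        conjSel₂ κ₁ κ₂ (WeierstrassCurve.geomPrimaryTorsion W p) vbar γ₂ s = s} := by
  classical
  have hp := (Fact.out : p.Prime)
  let H := ZpExtension.pairKer κ₁ κ₂
  let ιN := W.torsionToPrimaryH1Sub p H
  let S : Set (HeightOneSpectrum (𝓞 K)) := W.badPlaces (𝓞 K) ∪ {v | ((p : ℤ) : 𝓞 K) ∈ v.asIdeal}
  have hbad : (W.badPlaces (𝓞 K)).Finite := W.finite_badPlaces_holds (𝓞 K)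
  have hS : S.Finite :=
    hbad.union (WeierstrassCurve.finite_setOf_intCast_mem_asIdeal (by exact_mod_cast hp.ne_zero))
  have hSp : ∀ v : HeightOneSpectrum (𝓞 K), (p : 𝓞 K) ∈ v.asIdeal → v ∈ S := fun v hv ↦
    Or.inr (by simpa using hv)
  let Unr : subgroupH1 H (WeierstrassCurve.geomTorsion W (p : ℤ)) → Prop := fun x ↦
    ∀ v : HeightOneSpectrum (𝓞 K), v ∉ S → ∀ 𝔓 ∈ v.primesAbove,
      ∀ hle : 𝔓.inertia (Field.absoluteGaloisGroup K) ≤ H,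
        resOfLe (WeierstrassCurve.geomTorsion W (p : ℤ)) hle x = 0
  have hUnr_sub : ∀ x y, Unr x → Unr y → Unr (x - y) := fun x y hx hy v hv 𝔓 h𝔓 hle ↦ by
    rw [map_sub, hx v hv 𝔓 h𝔓 hle, hy v hv 𝔓 h𝔓 hle, sub_zero]
  haveI : Finite (WeierstrassCurve.geomTorsion W (p : ℤ)) :=
    WeierstrassCurve.finite_torsionPoints_holds W (AlgebraicClosure K) (by exact_mod_cast hp.ne_zero)
  haveI : ContinuousSMul (Field.absoluteGaloisGroup K) (WeierstrassCurve.geomTorsion W (p : ℤ)) :=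
    WeierstrassCurve.continuousSMul_geomTorsion W (WeierstrassCurve.isOpen_stabilizer_point_holds W) _
  have hpM : ∀ m : WeierstrassCurve.geomTorsion W (p : ℤ), p • m = 0 := fun m ↦
    Subtype.ext (by rw [AddSubgroupClass.coe_nsmul, ZeroMemClass.coe_zero]; exact
      AddSubgroup.torsionBy.nsmul_iff.mp m.2)
  have hA₀ := finite_setOf_conjH1_pair_eq_of_unramified (M := WeierstrassCurve.geomTorsion W (p : ℤ))
    hγ hpM hS hSp
  have hF₀ := W.finite_ker_torsionToPrimaryH1Sub p (H := H) W.zsmul_geomPoints_surjective_holds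
  have hL : Set.Finite {y : subgroupH1 H (WeierstrassCurve.geomTorsion W (p : ℤ)) |
      ιN y ∈ unrSelmer₂ κ₁ κ₂ (WeierstrassCurve.geomPrimaryTorsion W p) vbar ∧
        W.conjH1 p H γ₁ (ιN y) = ιN y ∧ W.conjH1 p H γ₂ (ιN y) = ιN y} := by
    have hsub : {y : subgroupH1 H (WeierstrassCurve.geomTorsion W (p : ℤ)) |
        ιN y ∈ unrSelmer₂ κ₁ κ₂ (WeierstrassCurve.geomPrimaryTorsion W p) vbar ∧
          W.conjH1 p H γ₁ (ιN y) = ιN y ∧ W.conjH1 p H γ₂ (ιN y) = ιN y} ⊆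
        ⋃ f₁ ∈ (ιN.ker : Set _), ⋃ f₂ ∈ (ιN.ker : Set _), {y | Unr y ∧
          conjH1 H (WeierstrassCurve.geomTorsion W (p : ℤ)) γ₁ y - y = f₁ ∧
          conjH1 H (WeierstrassCurve.geomTorsion W (p : ℤ)) γ₂ y - y = f₂} := by
      rintro y ⟨hy0, hy1, hy2⟩
      simp only [Set.mem_iUnion, Set.mem_setOf_eq, SetLike.mem_coe, exists_prop]
      refine ⟨_, ?_, _, ?_, ?_, rfl, rfl⟩
      · rw [AddMonoidHom.mem_ker, map_sub, ← WeierstrassCurve.conjH1_torsionToPrimaryH1Sub, hy1, sub_self]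
      · rw [AddMonoidHom.mem_ker, map_sub, ← WeierstrassCurve.conjH1_torsionToPrimaryH1Sub, hy2, sub_self]
      · intro v hv 𝔓 h𝔓 hle
        have hv' : v ∉ W.badPlaces (𝓞 K) := fun h ↦ hv (Or.inl h)
        have hpv : ((p : ℕ) : 𝓞 K) ∉ v.asIdeal := fun h ↦ hv (hSp v h)
        exact W.resOfLe_eq_zero_of_mem_unramifiedOutside (H := H) (S₀ := ∅)
          (unrSelmer₂_le_unramifiedOutside κ₁ κ₂ _ vbar hy0) (Set.notMem_empty v) hv' hpv h𝔓 hle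
    refine (hF₀.biUnion fun f₁ _ ↦ hF₀.biUnion fun f₂ _ ↦ ?_).subset hsub
    by_cases hne : {y | Unr y ∧ conjH1 H (WeierstrassCurve.geomTorsion W (p : ℤ)) γ₁ y - y = f₁ ∧
        conjH1 H (WeierstrassCurve.geomTorsion W (p : ℤ)) γ₂ y - y = f₂}.Nonempty
    · obtain ⟨y₀, hy₀U, hy₀1, hy₀2⟩ := hne
      refine (hA₀.image fun a ↦ y₀ + a).subset ?_
      rintro y ⟨hyU, hy1, hy2⟩
      refine ⟨y - y₀, ⟨?_, ?_, hUnr_sub y y₀ hyU hy₀U⟩, by abel⟩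
      · rw [map_sub, sub_eq_iff_eq_add.mp hy1, sub_eq_iff_eq_add.mp hy₀1]
        abel
      · rw [map_sub, sub_eq_iff_eq_add.mp hy2, sub_eq_iff_eq_add.mp hy₀2]
        abel
    · rw [Set.not_nonempty_iff_eq_empty.mp hne]
      exact Set.finite_empty
  refine ((hL.image ιN).preimage (Subtype.val_injective.injOn)).subset ?_
  rintro s ⟨hs0, hs1, hs2⟩
  have hps : p • (s : W.subgroupH1 p H) = 0 := by
    rw [← AddSubgroupClass.coe_nsmul, hs0, ZeroMemClass.coe_zero]
  obtain ⟨y, hy⟩ := W.exists_torsionToPrimaryH1Sub_eq p (H := H) W.zsmul_geomPoints_surjective_holds hps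
  refine ⟨y, ⟨?_, ?_, ?_⟩, hy⟩
  · show ιN y ∈ unrSelmer₂ κ₁ κ₂ (WeierstrassCurve.geomPrimaryTorsion W p) vbar
    rw [show ιN y = (s : W.subgroupH1 p H) from hy]; exact s.2
  · show W.conjH1 p H γ₁ (ιN y) = ιN y
    rw [show ιN y = (s : W.subgroupH1 p H) from hy]
    exact congrArg (fun z : unrSelmer₂ κ₁ κ₂ (WeierstrassCurve.geomPrimaryTorsion W p) vbar ↦
      (z : W.subgroupH1 p H)) hs1
  · show W.conjH1 p H γ₂ (ιN y) = ιN y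
    rw [show ιN y = (s : W.subgroupH1 p H) from hy]
    exact congrArg (fun z : unrSelmer₂ κ₁ κ₂ (WeierstrassCurve.geomPrimaryTorsion W p) vbar ↦
      (z : W.subgroupH1 p H)) hs2

/-- **`X_Gr(E/K̃_∞)` is finitely generated over `Λ₂ = ℤ_p⟦T₂⟧⟦T₁⟧`** — for every number field `K`,
elliptic `W/K`, prime `p`, `ℤ_p`-extensions `κ₁, κ₂` with a topological generator pair `(γ₁, γ₂)` and
place `v̄`: Nakayama for Pontryagin duals over `Λ₂` (`SignedBaseChangeAcDivNakayamaTwoVar.module_finite_of_dualPair₂`,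
w2) applied to the constructed dual pair `(XGr₂, id, conj_{γ₁} − 1, conj_{γ₂} − 1)` and the finiteness
`finite_unrSelmer₂_pTorsion_invariants`. Greenberg, LNM 1716 §1 p. 60; BCS 2025 §2.1 / Conj. 4.1.2
(the f.g. half of "`X_Gr(E/K_∞)` is a finitely generated torsion `Λ_K`-module"; torsion NOT proved here).
[cite: GreenbergLNM1716, §1 p. 60 (after Conj. 1.3)]
[cite: BurungaleCastellaSkinner2025, §2.1 (p. 6) and Conj. 4.1.2 (p. 8 of arXiv:2405.00270v2)] -/
theorem xGr₂_module_finite [Fact (ZpExtension.IsTopGeneratorPair κ₁ κ₂ γ₁ γ₂)] :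
    Module.Finite (IwasawaAlgebra₂ p) (W.XGr₂ p κ₁ κ₂ vbar γ₁ γ₂) := by
  have hpair : ZpExtension.IsTopGeneratorPair κ₁ κ₂ γ₁ γ₂ := Fact.out
  have hfin := finite_unrSelmer₂_pTorsion_invariants W p κ₁ κ₂ vbar hpair
  refine SignedBaseChangeAcDivNakayamaTwoVar.module_finite_of_dualPair₂ (p := p)
    (S := unrSelmer₂ κ₁ κ₂ (WeierstrassCurve.geomPrimaryTorsion W p) vbar) (X := W.XGr₂ p κ₁ κ₂ vbar γ₁ γ₂)
    (ψ₁ := conjSel₂ κ₁ κ₂ (WeierstrassCurve.geomPrimaryTorsion W p) vbar γ₁ - 1)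
    (ψ₂ := conjSel₂ κ₁ κ₂ (WeierstrassCurve.geomPrimaryTorsion W p) vbar γ₂ - 1)
    (AddMonoidHom.id _) Function.bijective_id (fun x s ↦ ?_) (fun x s ↦ ?_) (fun c x s k hk ↦ ?_)
    (TwoVariableSelmer.isLocNil₂_conjSel₂ (WeierstrassCurve.geomPrimaryTorsion W p) vbar hpair
      (W.exists_pow_smul_geomPrimaryTorsion_eq_zero p) (W.isOpen_stabilizer_geomPrimaryTorsion' p)) ?_
  · show ((PowerSeries.X : IwasawaAlgebra₂ p) • x) s =
      x ((conjSel₂ κ₁ κ₂ (WeierstrassCurve.geomPrimaryTorsion W p) vbar γ₁ - 1) s)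
    rw [WeierstrassCurve.XGr₂.X_smul_apply, IwasawaDual.End_sub_apply, AddMonoid.End.one_apply]
    exact (AddMonoidHom.map_sub (show unrSelmer₂ κ₁ κ₂ (WeierstrassCurve.geomPrimaryTorsion W p) vbar →+
      AddCircle (1 : ℚ) from x) _ _).symm
  · show ((PowerSeries.C (PowerSeries.X : IwasawaAlgebra p) : IwasawaAlgebra₂ p) • x) s =
      x ((conjSel₂ κ₁ κ₂ (WeierstrassCurve.geomPrimaryTorsion W p) vbar γ₂ - 1) s)
    rw [WeierstrassCurve.XGr₂.CX_smul_apply, IwasawaDual.End_sub_apply, AddMonoid.End.one_apply]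
    exact (AddMonoidHom.map_sub (show unrSelmer₂ κ₁ κ₂ (WeierstrassCurve.geomPrimaryTorsion W p) vbar →+
      AddCircle (1 : ℚ) from x) _ _).symm
  · show ((PowerSeries.C (PowerSeries.C c : IwasawaAlgebra p) : IwasawaAlgebra₂ p) • x) s =
      (PadicInt.toZModPow k c).val • x s
    exact WeierstrassCurve.XGr₂.CC_smul_apply W p κ₁ κ₂ vbar γ₁ γ₂ c x hk
  · refine hfin.subset fun s hs ↦ ?_
    obtain ⟨h0, h1, h2⟩ := hs
    rw [IwasawaDual.End_sub_apply, AddMonoid.End.one_apply, sub_eq_zero] at h1 h2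
    exact ⟨h0, h1, h2⟩

end Summit.BirchSwinnertonDyer.BirchSwinnertonDyer.Theorems.SignedBaseChangeAcDivFinitePiece
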